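import Mathlib
import HarnessLib
import Summits.CriticalPhenomena.PercolationContinuityZ3.Theses.PercBurnResprinkle

/-!
# Sketch (crux-ideate ideator 2, gen 2) — burnt-skeleton Markov property and
# self-level saturation of the vacant set

Crux `stmt-CriticalPhenomena-7205` (`PercBurnResprinkle.VacantSetPercolates`).
These are NOT idea-card first lemmas for 7205 (no new 7205 card is filed by this seat in gen 2);
they are the checkable statements behind the structural finding recorded in
`Cruxes/VacantSetPercolates/IDEATOR2-NOTES-g2.md`, relevant to items 7203/7204 of the route:

* `infSet_insert_of_vacant` / `infSet_diff_of_vacant` (deterministic, provable now): toggling a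
  lattice edge whose two endpoints lie in FINITE open clusters does not change the set `I(ω)` of
  vertices in infinite open clusters.  This is the combinatorial core of
* `BurntSkeletonMarkov` (Prop): replacing the configuration on the edges INSIDE the vacant set
  `V(ω) = ℤ³ ∖ I(ω)` by an independent `P_p`-sample reproduces `P_p` — i.e. conditionally on the
  burnt skeleton `(I(ω), ω|E(I) ∪ ∂I)` the edges inside `V` are i.i.d. Bernoulli(p); whence
* `SelfLevelSaturation` (Prop): `P_p ⊗ P_p`-a.s. a FRESH Bernoulli(p) field restricted to the
  edges inside `V(ω)` has no infinite cluster: `p_c(ℤ³[V_p]) ≥ p` for every `p`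
  (the route's "unknown constant C ≷ 1" satisfies `C ≥ 1`).
-/

namespace Summit.CriticalPhenomena.PercolationContinuityZ3.Cruxes.VacantSetPercolates.SketchIdeator2g2

open Literature.Probability.Percolation Literature.Probability.LatticeModels MeasureTheory

/-- Vertices of `ℤ³`. -/
abbrev V3 : Type := Fin 3 → ℤ

/-- `I(ω)`: vertices lying in an infinite open cluster (the burnt set). -/
def infSet (ω : BondConfig V3) : Set V3 := {y | (openCluster ω y).Infinite}

/-- `V(ω) = ℤ³ ∖ I(ω)`: vertices whose open cluster is finite (the vacant set of the crux). -/
def vacantSet (ω : BondConfig V3) : Set V3 := {y | (openCluster ω y).Finite}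

theorem vacantSet_eq_compl (ω : BondConfig V3) : vacantSet ω = (infSet ω)ᶜ := by
  ext y; simp only [vacantSet, infSet, Set.mem_setOf_eq, Set.mem_compl_iff, Set.Infinite, not_not]

/-- Deterministic core of the Markov property (insert): opening an edge between two vertices of
FINITE clusters merges two finite clusters and changes no infinite one. Provable now (S/M). -/
theorem infSet_insert_of_vacant (ω : BondConfig V3) (u v : V3)
    (hu : u ∈ vacantSet ω) (hv : v ∈ vacantSet ω) :
    infSet (insert s(u, v) ω) = infSet ω := by
  sorry

/-- Deterministic core of the Markov property (delete): closing an edge between two vertices of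
finite clusters changes no infinite cluster (no infinite open path uses it). Provable now (S). -/
theorem infSet_diff_of_vacant (ω : BondConfig V3) (u v : V3)
    (hu : u ∈ vacantSet ω) (hv : v ∈ vacantSet ω) :
    infSet (ω \ {s(u, v)}) = infSet ω := by
  sorry

/-- The "burn and refill" map: keep `ω` on the edges meeting `I(ω)` (its internal edges and its
closed boundary), take the fresh sample `ω'` on the edges inside `V(ω)`. -/
def refill (π : BondConfig V3 × BondConfig V3) : BondConfig V3 :=
  {e | (e ∈ π.1 ∧ ∃ y ∈ e, y ∈ infSet π.1) ∨ (e ∈ π.2 ∧ ∀ y ∈ e, y ∈ vacantSet π.1)}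

/-- BURNT-SKELETON MARKOV PROPERTY (distributional form): refilling the vacant set of a
`P_p`-sample with an independent `P_p`-sample gives again a `P_p`-sample.  Proof route: for a
fixed lattice edge `e`, on the `I`-measurable event `{both endpoints of e vacant}` the flip of `e`
preserves `(I, ω|E(I)∪∂I)` (the two lemmas above) and has the Bernoulli `p/(1-p)` cocycle, so
`P(e open | skeleton, all other edges) = p` there; chain rule ⇒ i.i.d. inside `V`. -/
def BurntSkeletonMarkov : Prop :=
  ∀ p : unitInterval,
    ((bondPercolation (zdGraph 3) p).prod (bondPercolation (zdGraph 3) p)).map refill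
      = bondPercolation (zdGraph 3) p

/-- SELF-LEVEL SATURATION: for every `p`, almost surely a fresh Bernoulli(p) configuration
restricted to the lattice edges inside the vacant set `V(ω)` has no infinite cluster, i.e.
`p_c(ℤ³[V_p]) ≥ p` (`V_p` is never fresh-supercritical at its own level).  Immediate from
`BurntSkeletonMarkov`: given the skeleton the fresh field on `E(V)` has the law of the actual one,
whose clusters are finite by definition of `V`. -/
def SelfLevelSaturation : Prop :=
  ∀ p : unitInterval,
    ((bondPercolation (zdGraph 3) p).prod (bondPercolation (zdGraph 3) p))
      {π | ∃ x : V3, (openCluster {e | e ∈ π.2 ∧ ∀ y ∈ e, y ∈ vacantSet π.1} x).Infinite} = 0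

/-- Book-keeping: self-level saturation in the two-label coupling used by the route file
(environment `U`, fresh field `U'` at the SAME level `p`): the vacant fresh configuration of
`VacantReignition`/`JumpFireBreak` with field level = environment level never percolates. -/
def SelfLevelSaturationLabels : Prop :=
  ∀ p : ℝ,
    ((labelMeasure V3).prod (labelMeasure V3))
      {π : (Sym2 V3 → ℝ) × (Sym2 V3 → ℝ) | ∃ x : V3,
        (openCluster {e | e ∈ configOfLabels p π.2 (zdGraph 3) ∧
          ∀ y ∈ e, ¬ (openCluster (configOfLabels p π.1 (zdGraph 3)) y).Infinite} x).Infinite} = 0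

end Summit.CriticalPhenomena.PercolationContinuityZ3.Cruxes.VacantSetPercolates.SketchIdeator2g2
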